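import Summits.ValiantsHypothesis.ValiantsHypothesis.Theorems.MonotoneRestorationMonotoneRestorationQPHomExpansionUnique
import Literature.Computability.AlgebraicComplexity.DiPatternExpressions
import HarnessLib

/-!
# Route MonotoneRestoration — aside `OrbitCompressionQP` (stmt-ValiantsHypothesis-18332): UNIQUENESS OF
# ONE-SORTED HOMOMORPHISM EXPANSIONS (directed looped patterns on `≤ n` vertices)

One-sorted twin of `HomExpansionUnique.homPoly_linearIndependent` (Dwivedi–Pago–Seppelt 2026, Lemma 8.18,
bipartite).  The directed looped homomorphism polynomials `diHomPoly E n` (`Literature.…DiPatternExpressions`)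
of pairwise NON-ISOMORPHIC directed multigraph patterns `(Fin (a i), E i)` WITHOUT ISOLATED VERTICES and with
`a i ≤ n` are linearly independent over a field of characteristic `0` (leading monomial of an injective
placement of a pattern with the most vertices).  This is ingredient (i) of the low-degree case of S1c
(item evidence `S1b-results.md`, §B): for a matrix-symmetric `f` with `2 deg f < n` the one-sorted and the
bipartite expansions coincide (edges oriented row → column), by this uniqueness.

* `coeff_diHomPoly` — coefficients count vertex maps pushing the pattern onto the monomial;
* `exists_diIso_of_map_eq` — a push-forward of a pattern without isolated vertices EXACTLY onto an injective
  placement of a pattern with at least as many vertices is an isomorphism;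
* `diHomPoly_linearIndependent` — the independence.

Helper file (`--supports stmt-ValiantsHypothesis-18332`); def-free; nothing here is a named fact.
-/

noncomputable section

open MvPolynomial

-- `Summit.ValiantsHypothesis.ValiantsHypothesis.…` is the tree's single-conjunct layout (Sub = Summit).
set_option linter.dupNamespace false

namespace Summit.ValiantsHypothesis.ValiantsHypothesis.Theorems

namespace DiHomExpansionUnique

open Literature.Computability.AlgebraicComplexity

universe u

variable {K : Type} [Field K]

/-- **Coefficients of a one-sorted homomorphism polynomial count vertex maps.**
[cite: DawarPagoSeppelt2025, §7 (p. 45)] -/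
theorem coeff_diHomPoly {V : Type u} [Fintype V] [DecidableEq V] (E : Multiset (V × V)) (n : ℕ)
    (D : (Fin n × Fin n) →₀ ℕ) :
    coeff D (diHomPoly E n K) =
      ((Finset.univ.filter fun h : V → Fin n =>
          Multiset.toFinsupp ((E.map fun e => (h e.1, h e.2))) = D).card : K) := by
  classical
  unfold diHomPoly
  rw [coeff_sum]
  simp only [HomExpansionUnique.prod_map_X_eq_monomial, coeff_monomial]
  rw [Finset.sum_boole]

/-- **A surjective push-forward between directed patterns of the same order is an isomorphism.** If the
edge multiset of `(V, E)` (no isolated vertices) is pushed forward by `h : V → W` exactly onto an injective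
placement `ι` of `(V₀, E₀)` (no isolated vertices) and `|V| ≤ |V₀|`, then the patterns are isomorphic.
[cite: DwivediPagoSeppelt2026, Lemma 8.18 (proof)] -/
theorem exists_diIso_of_map_eq {V V₀ W : Type*} [Fintype V] [Fintype V₀] (E : Multiset (V × V))
    (E₀ : Multiset (V₀ × V₀)) (h : V → W) (ι : V₀ → W) (hι : Function.Injective ι)
    (hvert : ∀ u : V, ∃ e ∈ E, e.1 = u ∨ e.2 = u) (hvert₀ : ∀ u : V₀, ∃ e ∈ E₀, e.1 = u ∨ e.2 = u)
    (hcard : Fintype.card V ≤ Fintype.card V₀)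
    (heq : (E.map fun e => (h e.1, h e.2)) = (E₀.map fun e => (ι e.1, ι e.2))) :
    ∃ ea : V ≃ V₀, (E.map fun e => (ea e.1, ea e.2)) = E₀ := by
  classical
  have hV : ∀ u : V, ∃ u₀ : V₀, ι u₀ = h u := by
    intro u
    obtain ⟨e, he, hu⟩ := hvert u
    have hm : (h e.1, h e.2) ∈ (E₀.map fun e => (ι e.1, ι e.2)) := by
      rw [← heq]; exact Multiset.mem_map_of_mem _ he
    obtain ⟨e₀, -, he₀⟩ := Multiset.mem_map.1 hm
    rcases hu with rfl | rfl
    · exact ⟨e₀.1, (Prod.mk.inj he₀).1⟩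
    · exact ⟨e₀.2, (Prod.mk.inj he₀).2⟩
  have hV₀ : ∀ u₀ : V₀, ∃ u : V, h u = ι u₀ := by
    intro u₀
    obtain ⟨e₀, he₀, hu⟩ := hvert₀ u₀
    have hm : (ι e₀.1, ι e₀.2) ∈ (E.map fun e => (h e.1, h e.2)) := by
      rw [heq]; exact Multiset.mem_map_of_mem _ he₀
    obtain ⟨e, -, he⟩ := Multiset.mem_map.1 hm
    rcases hu with rfl | rfl
    · exact ⟨e.1, (Prod.mk.inj he).1⟩
    · exact ⟨e.2, (Prod.mk.inj he).2⟩
  choose ea hea using hV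
  have hea_surj : Function.Surjective ea := by
    intro u₀
    obtain ⟨u, hu⟩ := hV₀ u₀
    exact ⟨u, hι (by rw [hea u, hu])⟩
  have hc : Fintype.card V₀ ≤ Fintype.card V := Fintype.card_le_of_surjective ea hea_surj
  have hea_bij : Function.Bijective ea :=
    (Fintype.bijective_iff_surjective_and_card ea).2 ⟨hea_surj, by omega⟩
  refine ⟨Equiv.ofBijective ea hea_bij, ?_⟩
  have hinj : Function.Injective fun e : V₀ × V₀ => (ι e.1, ι e.2) := fun p q hpq => by
    obtain ⟨h1, h2⟩ := Prod.mk.inj hpq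
    exact Prod.ext (hι h1) (hι h2)
  apply Multiset.map_injective hinj
  rw [← heq]
  simp only [Multiset.map_map, Function.comp_def, Equiv.ofBijective_apply, hea]

/-- **UNIQUENESS OF ONE-SORTED HOMOMORPHISM EXPANSIONS.**  The polynomials `diHomPoly (E i) n` of pairwise
non-isomorphic directed looped multigraph patterns `(Fin (a i), E i)` without isolated vertices and with
`a i ≤ n` are linearly independent over a field of characteristic `0`.
[cite: DwivediPagoSeppelt2026, Lemma 8.18 (one-sorted analogue)] [cite: DawarPagoSeppelt2025, §7 (p. 45)] -/
theorem diHomPoly_linearIndependent [CharZero K] (n m : ℕ) (a : Fin m → ℕ)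
    (E : (i : Fin m) → Multiset (Fin (a i) × Fin (a i))) (α : Fin m → K)
    (hle : ∀ i, a i ≤ n)
    (hvert : ∀ i (u : Fin (a i)), ∃ e ∈ E i, e.1 = u ∨ e.2 = u)
    (hiso : ∀ i j, i ≠ j → ∀ ea : Fin (a i) ≃ Fin (a j), ((E i).map fun e => (ea e.1, ea e.2)) ≠ E j)
    (hsum : ∑ i, C (α i) * diHomPoly (E i) n K = 0) :
    α = 0 := by
  classical
  by_contra hα
  set S : Finset (Fin m) := Finset.univ.filter fun i => α i ≠ 0 with hS
  have hSne : S.Nonempty := by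
    obtain ⟨i, hi⟩ := Function.ne_iff.1 hα
    exact ⟨i, Finset.mem_filter.2 ⟨Finset.mem_univ _, hi⟩⟩
  obtain ⟨i₀, hi₀S, hmax⟩ := S.exists_max_image (fun i => a i) hSne
  have hαi₀ : α i₀ ≠ 0 := (Finset.mem_filter.1 hi₀S).2
  let ι : Fin (a i₀) → Fin n := Fin.castLE (hle i₀)
  have hι : Function.Injective ι := Fin.castLE_injective _
  let D₀ : (Fin n × Fin n) →₀ ℕ := Multiset.toFinsupp (((E i₀).map fun e => (ι e.1, ι e.2)))
  have hcoeff : ∑ i, α i * ((Finset.univ.filter fun h : Fin (a i) → Fin n =>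
      Multiset.toFinsupp (((E i).map fun e => (h e.1, h e.2))) = D₀).card : K) = 0 := by
    have := congrArg (coeff D₀) hsum
    simpa only [coeff_sum, coeff_C_mul, coeff_diHomPoly, coeff_zero] using this
  rw [Finset.sum_eq_single i₀] at hcoeff
  · have hpos : (Finset.univ.filter fun h : Fin (a i₀) → Fin n =>
        Multiset.toFinsupp (((E i₀).map fun e => (h e.1, h e.2))) = D₀).card ≠ 0 := by
      rw [← Nat.pos_iff_ne_zero, Finset.card_pos]
      exact ⟨ι, Finset.mem_filter.2 ⟨Finset.mem_univ _, rfl⟩⟩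
    exact (mul_ne_zero hαi₀ (Nat.cast_ne_zero.2 hpos)) hcoeff
  · intro i _ hi
    by_cases hαi : α i = 0
    · rw [hαi, zero_mul]
    have hiS : i ∈ S := Finset.mem_filter.2 ⟨Finset.mem_univ _, hαi⟩
    have hcard : Fintype.card (Fin (a i)) ≤ Fintype.card (Fin (a i₀)) := by
      simpa only [Fintype.card_fin] using hmax i hiS
    suffices h0 : (Finset.univ.filter fun h : Fin (a i) → Fin n =>
        Multiset.toFinsupp (((E i).map fun e => (h e.1, h e.2))) = D₀) = ∅ by
      rw [h0, Finset.card_empty, Nat.cast_zero, mul_zero]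
    rw [Finset.filter_eq_empty_iff]
    intro h _ hD
    have heq : ((E i).map fun e => (h e.1, h e.2)) = ((E i₀).map fun e => (ι e.1, ι e.2)) :=
      Multiset.toFinsupp.injective hD
    obtain ⟨ea, hE⟩ := exists_diIso_of_map_eq (E i) (E i₀) h ι hι (hvert i) (hvert i₀) hcard heq
    exact hiso i i₀ hi ea hE
  · intro h; exact absurd (Finset.mem_univ i₀) h

end DiHomExpansionUnique

end Summit.ValiantsHypothesis.ValiantsHypothesis.Theorems

end
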